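import Literature.NumberTheory.EllipticCurves.ComplexMultiplicationCoatesWilesReductionIndexProofs
import Literature.NumberTheory.EllipticCurves.ComplexMultiplicationCoatesWilesSeparationProofs
import Literature.NumberTheory.EllipticCurves.PadicFiltrationIndexProofs
import Literature.NumberTheory.EllipticCurves.PadicPointsHomFiltrationProofs
import Literature.NumberTheory.EllipticCurves.ReductionHomomorphismSurjectiveProofs
import Literature.NumberTheory.EllipticCurves.GeomPointReduction
import Literature.NumberTheory.EllipticCurves.VariableChangePointsMap
import Literature.NumberTheory.EllipticCurves.PadicFormalLogOrder
import HarnessLib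

/-!
# Torsion and cotorsion of `E(ℚ_q)` at a good prime `q ∤ n` are those of the reduction:
# `E(ℚ_q)[n] ≃ Ẽ(𝔽_q)[n]` and `E(ℚ_q)/n ≃ Ẽ(𝔽_q)/n` (Silverman, *AEC* VII.2.1, VII.3.1, IV.2.3)

Topic `NumberTheory/EllipticCurves`; a proofs-only file (theorems only: no definition, no named
fact, no `sorry`; net named-fact debt `0`).  For a globally minimal elliptic `W/ℚ` and a prime
`q ∤ Δ_W` (good reduction) the tree has the exact sequence of Silverman, *AEC* VII.2.1,
`0 → E₁(ℚ_q) → E(ℚ_q) → Ẽ(𝔽_q) → 0` for the `ℤ_q`-model `(integralModelInt W) ⊗ ℤ_q`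
(`goodReductionHom`, onto by Hensel `exists_reducePoint_eq`, kernel `E₁` by
`goodReductionHom_eq_zero_iff` / `reducesToZero_iff_isInReductionKernel`; the models agree over
`ℚ_q`, `padicModel_baseChange`).  This file adds the classical consequence for every `n` prime to
`q` (*AEC* VII.3.1(b): "the reduction map is injective on `E(K)[m]` for `m` prime to `p`", with its
surjective half and the cokernel twin, both because `[n]` is an AUTOMORPHISM of the formal group
`Ê(qℤ_q) ≅ E₁(ℚ_q)` for `n ∈ ℤ_qˣ`, *AEC* IV.2.3 / IV.6.4):

* §1 (pure algebra; private helpers) for a surjection `r : B → C` of abelian groups whose kernel is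
  `n`-torsion-free and `n`-divisible: `B[n] ≃+ C[n]` (`nonempty_kerEquiv_of_surjective`),
  `B[n] = 0 ↔ C[n] = 0`, and `b ∈ nB ↔ r b ∈ nC` (`exists_nsmul_eq_iff_of_surjective`);
* §2 for ANY `p`, any `p`-integral elliptic equation `X/ℚ_p` and `p ∤ n`: `E₁(ℚ_p)` has no
  `n`-torsion (`WeierstrassCurve.eq_zero_of_nsmul_eq_zero_of_isInReductionKernel`, from the tree's
  `‖z(nP)‖ = ‖z(P)‖`, `norm_formalParameter_nsmul_of_not_dvd`) and is `n`-divisible inside itself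
  (`WeierstrassCurve.exists_nsmul_eq_of_isInReductionKernel`: on the tree's filtration
  `E₁ = E⁽⁰⁾ = E⁽¹⁾ ⊇ E⁽²⁾`, `[E⁽¹⁾ : E⁽²⁾] = p` (`relIndex_formalFiltration_succ`) and
  `E⁽²⁾ ⊆ n·E⁽²⁾` (`formalFiltration_le_nsmul`, `v_p(n) = 0`), by Bézout `an + bp = 1`); hence, for
  ANY reduction type, `E(ℚ_p)[n] ≃+ (E(ℚ_p)/E₁(ℚ_p))[n]`
  (`nonempty_kerEquiv_quotient_formalFiltration`, `forall_nsmul_eq_zero_iff_quotient_formalFiltration`;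
  the quotient has order `c_p · #Ẽ_ns(𝔽_p)`, tree `index_formalFiltration` / `formalIndex`);
* §3 for `W/ℚ` globally minimal, `q ∤ Δ_W`: the reduction map read on `(W ⊗ ℚ_q)`-points (transport
  along `padicModel_baseChange`, the identity on coordinates) is onto with kernel `E₁(ℚ_q)`
  (`reducePoint_congrEquiv_surjective`, `reducePoint_congrEquiv_eq_zero_iff`); hence for `q ∤ n`
  **`WeierstrassCurve.nonempty_kerEquiv_reduction : E(ℚ_q)[n] ≃+ Ẽ(𝔽_q)[n]`**,
  `forall_nsmul_eq_zero_iff_reduction` (`E(ℚ_q)[n] = 0 ↔ Ẽ(𝔽_q)[n] = 0`) and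
  `exists_nsmul_eq_iff_reduction` (`P ∈ n·E(ℚ_q) ↔ P̃ ∈ n·Ẽ(𝔽_q)`).  The reduced curve is written
  out as `((integralModelInt W).map (Int.castRingHom ℤ_[q])).map (IsLocalRing.residue ℤ_[q])`; its
  points are counted by `reductionPointCount W q` (`natCard_point_padicModel_residue`), so they form
  

Consumer: the O5 class-closure lane of `Summits/BirchSwinnertonDyer/Rank1Residual/` (harvest seat
2, GEN 58, E115: the census predicates `NoLocalThreeTorsionAt`, `FullLocalThreeTorsionAt`,
`LocallyThreeDivisibleAt` at a good prime `q ≠ 3` are statements about `Ẽ(𝔽_q)`, file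
`O5/GoodReductionLocalThreeTorsion.lean`).  The `K_v`/`adicCompletion` twin of §2 for a number
field is `X11b.LocalPurity.kernelOfReduction_nsmul_divisible` / `…_torsionFree` (Summits side).

## References

* J. H. Silverman, *The Arithmetic of Elliptic Curves*, 2nd ed., GTM 106 (2009): Prop. IV.2.3,
  Prop. IV.3.2, Thm. IV.6.4(b), Prop. VII.2.1, Prop. VII.2.2, Prop. VII.3.1(b). [SilvermanAEC2009]

## Design

Theorems only (D-0026); `noncomputable section`, `open scoped Classical` (Mathlib's group law on
`Affine.Point`), as in the formal-group files it combines.  Axioms: `propext`, `Classical.choice`,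
`Quot.sound`.
-/

set_option autoImplicit false

noncomputable section

open scoped Classical

namespace Literature.NumberTheory.EllipticCurves.GoodReductionTorsion

/-! ## §1 Algebra: a surjection whose kernel is uniquely `n`-divisible -/

section Algebra

/-- Membership in the kernel of `zsmulAddGroupHom (n : ℤ)` is `n • x = 0` (`n : ℕ`). [folklore] -/
private theorem mem_ker_zsmulAddGroupHom_iff_nsmul {M : Type*} [AddCommGroup M] (n : ℕ) (x : M) :
    x ∈ (zsmulAddGroupHom (n : ℤ) : M →+ M).ker ↔ n • x = 0 := by
  rw [AddMonoidHom.mem_ker, zsmulAddGroupHom_apply, natCast_zsmul]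

variable {B C : Type*} [AddCommGroup B] [AddCommGroup C] (r : B →+ C)

/-- Lifting `n`-torsion along a surjection with `n`-divisible kernel: every `c ∈ C[n]` is `r b`
for some `b ∈ B[n]`. [folklore] -/
private theorem exists_nsmul_eq_zero_lift (hr : Function.Surjective r) {n : ℕ}
    (hdiv : ∀ b, r b = 0 → ∃ b', r b' = 0 ∧ n • b' = b) {c : C} (hc : n • c = 0) :
    ∃ b : B, n • b = 0 ∧ r b = c := by
  obtain ⟨b, rfl⟩ := hr c
  obtain ⟨b', hb'0, hb'⟩ := hdiv (n • b) (by rw [map_nsmul]; exact hc)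
  exact ⟨b - b', by rw [nsmul_sub, ← hb', sub_self], by rw [map_sub, hb'0, sub_zero]⟩

/-- **`B[n] ≃+ C[n]`** for a surjection `r : B → C` of abelian groups whose kernel has no
`n`-torsion and is `n`-divisible (the restriction of `r`). [folklore] -/
private theorem nonempty_kerEquiv_of_surjective (hr : Function.Surjective r) (n : ℕ)
    (htf : ∀ b, r b = 0 → n • b = 0 → b = 0)
    (hdiv : ∀ b, r b = 0 → ∃ b', r b' = 0 ∧ n • b' = b) :
    Nonempty ((zsmulAddGroupHom (n : ℤ) : B →+ B).ker ≃+ (zsmulAddGroupHom (n : ℤ) : C →+ C).ker) := by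
  have hmap : ∀ b : (zsmulAddGroupHom (n : ℤ) : B →+ B).ker,
      r b ∈ (zsmulAddGroupHom (n : ℤ) : C →+ C).ker := fun b ↦
    (mem_ker_zsmulAddGroupHom_iff_nsmul n _).mpr
      (by rw [← map_nsmul, (mem_ker_zsmulAddGroupHom_iff_nsmul n _).mp b.2, map_zero])
  let φ : (zsmulAddGroupHom (n : ℤ) : B →+ B).ker →+ (zsmulAddGroupHom (n : ℤ) : C →+ C).ker :=
    { toFun := fun b ↦ ⟨r b, hmap b⟩
      map_zero' := Subtype.ext (by simp)
      map_add' := fun a b ↦ Subtype.ext (by simp) }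
  refine ⟨AddEquiv.ofBijective φ ⟨?_, ?_⟩⟩
  · rw [injective_iff_map_eq_zero]
    intro b hb
    have h0 : r b = 0 := congrArg Subtype.val hb
    exact Subtype.ext (htf b h0 ((mem_ker_zsmulAddGroupHom_iff_nsmul n _).mp b.2))
  · intro c
    obtain ⟨b, hb, hbc⟩ := exists_nsmul_eq_zero_lift r hr hdiv
      ((mem_ker_zsmulAddGroupHom_iff_nsmul n _).mp c.2)
    exact ⟨⟨b, (mem_ker_zsmulAddGroupHom_iff_nsmul n _).mpr hb⟩, Subtype.ext hbc⟩

/-- **`B[n] = 0 ↔ C[n] = 0`** in the same situation. [folklore] -/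
private theorem forall_nsmul_eq_zero_iff_of_surjective (hr : Function.Surjective r) {n : ℕ}
    (htf : ∀ b, r b = 0 → n • b = 0 → b = 0)
    (hdiv : ∀ b, r b = 0 → ∃ b', r b' = 0 ∧ n • b' = b) :
    (∀ b : B, n • b = 0 → b = 0) ↔ ∀ c : C, n • c = 0 → c = 0 := by
  constructor
  · intro hB c hc
    obtain ⟨b, hb, rfl⟩ := exists_nsmul_eq_zero_lift r hr hdiv hc
    rw [hB b hb, map_zero]
  · intro hC b hb
    have h0 : r b = 0 := hC (r b) (by rw [← map_nsmul, hb, map_zero])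
    exact htf b h0 hb

/-- **`b ∈ nB ↔ r b ∈ nC`** in the same situation (the cokernel side). [folklore] -/
private theorem exists_nsmul_eq_iff_of_surjective (hr : Function.Surjective r) {n : ℕ}
    (hdiv : ∀ b, r b = 0 → ∃ b', r b' = 0 ∧ n • b' = b) (b : B) :
    (∃ b₀ : B, n • b₀ = b) ↔ ∃ c₀ : C, n • c₀ = r b := by
  constructor
  · rintro ⟨b₀, rfl⟩
    exact ⟨r b₀, (map_nsmul r n b₀).symm⟩
  · rintro ⟨c₀, hc₀⟩
    obtain ⟨b₁, rfl⟩ := hr c₀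
    obtain ⟨b', -, hb'⟩ := hdiv (b - n • b₁) (by rw [map_sub, map_nsmul, ← hc₀, sub_self])
    exact ⟨b' + b₁, by rw [nsmul_add, hb', sub_add_cancel]⟩

end Algebra

end Literature.NumberTheory.EllipticCurves.GoodReductionTorsion

namespace WeierstrassCurve

open Literature.NumberTheory.EllipticCurves Literature.NumberTheory.EllipticCurves.GoodReductionTorsion

/-! ## §2 The kernel of reduction `E₁(ℚ_p)` is uniquely `n`-divisible for `p ∤ n` -/

section FormalGroup

variable {p : ℕ} [Fact p.Prime] (X : WeierstrassCurve ℚ_[p]) [X.IsIntegral ℤ_[p]] [X.IsElliptic]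

/-- **`E₁(ℚ_p)` has no `n`-torsion for `p ∤ n`** (Silverman *AEC* IV.3.2(b) / VII.3.1: on the
kernel of reduction `‖z(nP)‖ = ‖z(P)‖`, tree `norm_formalParameter_nsmul_of_not_dvd`).
[cite: SilvermanAEC2009, Prop. VII.3.1 and IV.3.2(b)] -/
theorem eq_zero_of_nsmul_eq_zero_of_isInReductionKernel {n : ℕ} (hn : ¬ p ∣ n)
    {P : X.toAffine.Point} (hP : X.IsInReductionKernel P) (h0 : n • P = 0) : P = 0 := by
  have h := X.norm_formalParameter_nsmul_of_not_dvd hn hP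
  rw [h0, X.formalParameter_zero, norm_zero] at h
  exact (X.formalParameter_eq_zero_iff hP).mp (norm_eq_zero.mp h.symm)

/-- **`E₁(ℚ_p)` is `n`-divisible inside itself for `p ∤ n`** (Silverman *AEC* IV.2.3 / IV.6.4:
`[n]` is an automorphism of the formal group `Ê(pℤ_p) ≅ E₁(ℚ_p)` when `n ∈ ℤ_pˣ`). Proof on the
tree's filtration: `E₁ = E⁽⁰⁾ = E⁽¹⁾ ⊇ E⁽²⁾` with `[E⁽¹⁾ : E⁽²⁾] = p`
(`relIndex_formalFiltration_succ`), so `p • P ∈ E⁽²⁾`; `E⁽²⁾ ⊆ n • E⁽²⁾`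
(`formalFiltration_le_nsmul`, `v_p(n) = 0`), so `p • P = n • Q₀`; and Bézout `a n + b p = 1` gives
`P = n • (a • P + b • Q₀)`. [cite: SilvermanAEC2009, Prop. IV.2.3 and Thm. IV.6.4(b)] -/
theorem exists_nsmul_eq_of_isInReductionKernel {n : ℕ} (hn : ¬ p ∣ n) {P : X.toAffine.Point}
    (hP : X.IsInReductionKernel P) :
    ∃ Q : X.toAffine.Point, X.IsInReductionKernel Q ∧ n • Q = P := by
  have hp : p.Prime := Fact.out
  have hn0 : n ≠ 0 := by rintro rfl; exact hn (dvd_zero p)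
  have hP0 : P ∈ X.formalFiltration 0 := X.mem_formalFiltration_zero_iff.mpr hP
  have hP1 : P ∈ X.formalFiltration 1 := by rw [X.formalFiltration_one_eq_zero]; exact hP0
  -- `p • P ∈ E⁽²⁾`
  have hrel : (X.formalFiltration 2).relIndex (X.formalFiltration 1) = p :=
    X.relIndex_formalFiltration_succ (n := 1) le_rfl
  have hpP : p • P ∈ X.formalFiltration 2 := by
    have h := (X.formalFiltration 2).nsmul_relIndex_mem (K := X.formalFiltration 1) hP1
    rwa [hrel] at h
  -- `E⁽²⁾ ⊆ n • E⁽²⁾`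
  have hv : padicValNat p n = 0 := padicValNat.eq_zero_of_not_dvd hn
  obtain ⟨Q₀, hQ₀, hQ₀eq⟩ := X.formalFiltration_le_nsmul (N := 2) le_rfl hn0 (Q := p • P)
    (by rw [hv, add_zero]; exact hpP)
  have hQ₀0 : Q₀ ∈ X.formalFiltration 0 := X.formalFiltration_antitone (Nat.zero_le 2) hQ₀
  -- Bézout
  have hcop : Nat.Coprime n p := Nat.coprime_comm.mp ((Nat.Prime.coprime_iff_not_dvd hp).mpr hn)
  obtain ⟨a, b, hab⟩ := Nat.isCoprime_iff_coprime.mpr hcop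
  refine ⟨a • P + b • Q₀, X.mem_formalFiltration_zero_iff.mp
    (add_mem (AddSubgroup.zsmul_mem _ hP0 a) (AddSubgroup.zsmul_mem _ hQ₀0 b)), ?_⟩
  have h1 : (n : ℤ) • Q₀ = (p : ℤ) • P := by rw [natCast_zsmul, hQ₀eq, natCast_zsmul]
  have h2 : (n : ℤ) • (a • P + b • Q₀) = (a * n + b * p) • P := by
    rw [zsmul_add, ← mul_zsmul, ← mul_zsmul, mul_comm (n : ℤ) a, mul_comm (n : ℤ) b, mul_zsmul Q₀ b,
      h1, ← mul_zsmul, ← add_zsmul]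
  rw [← natCast_zsmul, h2, hab, one_zsmul]

/-- **`E(ℚ_p)[n] ≃+ (E(ℚ_p)/E₁(ℚ_p))[n]` for `p ∤ n`** (any `p`-integral elliptic equation, any
reduction type): the quotient map `E(ℚ_p) → E(ℚ_p)/E₁(ℚ_p)` is onto with uniquely `n`-divisible
kernel `E₁(ℚ_p) = E⁽¹⁾` (Silverman *AEC* VII.3.1(b) in the form "prime-to-`p` torsion injects into
`E(K)/E₁(K)`", with its surjective half; `[E(ℚ_p) : E₁(ℚ_p)] = c_p · #Ẽ_ns(𝔽_p)`, tree
`index_formalFiltration`). [cite: SilvermanAEC2009, Prop. VII.3.1(b) with Prop. VII.2.1 and VII.2.2] -/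
theorem nonempty_kerEquiv_quotient_formalFiltration {n : ℕ} (hn : ¬ p ∣ n) :
    Nonempty ((zsmulAddGroupHom (n : ℤ) : X.toAffine.Point →+ _).ker ≃+
      (zsmulAddGroupHom (n : ℤ) : (X.toAffine.Point ⧸ X.formalFiltration 1) →+ _).ker) := by
  have hker : ∀ P, QuotientAddGroup.mk' (X.formalFiltration 1) P = 0 ↔ X.IsInReductionKernel P :=
    fun P ↦ by
      rw [QuotientAddGroup.mk'_apply, QuotientAddGroup.eq_zero_iff, X.formalFiltration_one_eq_zero,
        X.mem_formalFiltration_zero_iff]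
  refine nonempty_kerEquiv_of_surjective _ (QuotientAddGroup.mk'_surjective _) n
    (fun b hb hnb ↦ ?_) (fun b hb ↦ ?_)
  · exact X.eq_zero_of_nsmul_eq_zero_of_isInReductionKernel hn ((hker b).mp hb) hnb
  · obtain ⟨b', hb', h⟩ := X.exists_nsmul_eq_of_isInReductionKernel hn ((hker b).mp hb)
    exact ⟨b', (hker b').mpr hb', h⟩

/-- **`E(ℚ_p)[n] = 0 ↔ (E(ℚ_p)/E₁(ℚ_p))[n] = 0` for `p ∤ n`** (same sequence; with
`#(E(ℚ_p)/E₁(ℚ_p)) = c_p · #Ẽ_ns(𝔽_p)` this is the test "`n ∤ c_p · #Ẽ_ns(𝔽_p)`" for a prime `n`).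
[cite: SilvermanAEC2009, Prop. VII.3.1(b) with Prop. VII.2.1 and VII.2.2] -/
theorem forall_nsmul_eq_zero_iff_quotient_formalFiltration {n : ℕ} (hn : ¬ p ∣ n) :
    (∀ P : X.toAffine.Point, n • P = 0 → P = 0) ↔
      ∀ x : X.toAffine.Point ⧸ X.formalFiltration 1, n • x = 0 → x = 0 := by
  have hker : ∀ P, QuotientAddGroup.mk' (X.formalFiltration 1) P = 0 ↔ X.IsInReductionKernel P :=
    fun P ↦ by
      rw [QuotientAddGroup.mk'_apply, QuotientAddGroup.eq_zero_iff, X.formalFiltration_one_eq_zero,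
        X.mem_formalFiltration_zero_iff]
  refine forall_nsmul_eq_zero_iff_of_surjective _ (QuotientAddGroup.mk'_surjective _)
    (fun b hb hnb ↦ ?_) (fun b hb ↦ ?_)
  · exact X.eq_zero_of_nsmul_eq_zero_of_isInReductionKernel hn ((hker b).mp hb) hnb
  · obtain ⟨b', hb', h⟩ := X.exists_nsmul_eq_of_isInReductionKernel hn ((hker b).mp hb)
    exact ⟨b', (hker b').mpr hb', h⟩

end FormalGroup

/-! ## §3 The reduction map at a good prime, read on `(W ⊗ ℚ_q)`-points -/

section Congr

variable {F : Type*} [Field F]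

/-- `congrEquiv h.symm (congrEquiv h P) = P`. [folklore] -/
private theorem congrEquiv_symm_congrEquiv {X₁ X₂ : WeierstrassCurve F} (h : X₁ = X₂)
    (P : X₁.toAffine.Point) :
    Affine.Point.congrEquiv h.symm (Affine.Point.congrEquiv h P) = P := by
  subst h; rfl

/-- Transport along an equality of equations preserves the kernel of reduction (identity on
coordinates). [folklore] -/
private theorem isInReductionKernel_congrEquiv_iff {p : ℕ} [Fact p.Prime] {X₁ X₂ : WeierstrassCurve ℚ_[p]}
    (h : X₁ = X₂) (P : X₁.toAffine.Point) :
    X₂.IsInReductionKernel (Affine.Point.congrEquiv h P) ↔ X₁.IsInReductionKernel P := by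
  subst h; exact Iff.rfl

end Congr

section GoodPrime

variable (W : WeierstrassCurve ℚ) [W.IsElliptic] [W.IsGloballyMinimal] (q : ℕ) [Fact q.Prime]

variable {W q}

omit [W.IsElliptic] in
/-- **The reduction map `E(ℚ_q) → W̃(𝔽_q)` at a good prime is onto** (Hensel; Silverman *AEC*
VII.2.1, tree `exists_reducePoint_eq`), read on `(W ⊗ ℚ_q)`-points through
`padicModel_baseChange` (valid for every `q`: the reduced cubic's nonsingular points all lift).
[cite: SilvermanAEC2009, Prop. VII.2.1] -/
theorem reducePoint_congrEquiv_surjective :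
    Function.Surjective fun P : (W.baseChange ℚ_[q]).toAffine.Point ↦
      reducePoint ((integralModelInt W).map (Int.castRingHom ℤ_[q]))
        (Affine.Point.congrEquiv (W.padicModel_baseChange q).symm P) := by
  intro c
  obtain ⟨P, -, hP⟩ := ((integralModelInt W).map (Int.castRingHom ℤ_[q])).exists_reducePoint_eq
    (padicInt_valuationIntegers q).hom_inj c
  refine ⟨Affine.Point.congrEquiv (W.padicModel_baseChange q) P, ?_⟩
  change reducePoint _ (Affine.Point.congrEquiv _ (Affine.Point.congrEquiv _ P)) = c
  rw [congrEquiv_symm_congrEquiv, hP]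

omit [W.IsElliptic] in
/-- **Its kernel is `E₁(ℚ_q)`** (Silverman *AEC* VII.2.1; tree `goodReductionHom_eq_zero_iff`,
`reducesToZero_iff_isInReductionKernel`). [cite: SilvermanAEC2009, Prop. VII.2.1] -/
theorem reducePoint_congrEquiv_eq_zero_iff (hgood : ¬ (q : ℤ) ∣ minimalDiscriminantInt W)
    (P : (W.baseChange ℚ_[q]).toAffine.Point) :
    reducePoint ((integralModelInt W).map (Int.castRingHom ℤ_[q]))
        (Affine.Point.congrEquiv (W.padicModel_baseChange q).symm P) = 0 ↔
      (W.baseChange ℚ_[q]).IsInReductionKernel P := by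
  set V := (integralModelInt W).map (Int.castRingHom ℤ_[q]) with hV
  have hΔ : IsUnit V.Δ := W.isUnit_Δ_padicModel q hgood
  rw [← goodReductionHom_apply (padicInt_valuationIntegers q) hΔ,
    goodReductionHom_eq_zero_iff (padicInt_valuationIntegers q) hΔ,
    V.reducesToZero_iff_isInReductionKernel, isInReductionKernel_congrEquiv_iff]

omit [W.IsElliptic] in
/-- The reduction map as a homomorphism on `(W ⊗ ℚ_q)`-points (tree `goodReductionHom` composed
with the coordinate-identity transport). [cite: SilvermanAEC2009, Prop. VII.2.1] -/
theorem exists_reductionHom (hgood : ¬ (q : ℤ) ∣ minimalDiscriminantInt W) :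
    ∃ r : (W.baseChange ℚ_[q]).toAffine.Point →+
        (((integralModelInt W).map (Int.castRingHom ℤ_[q])).map
          (IsLocalRing.residue ℤ_[q])).toAffine.Point,
      ∀ P, r P = reducePoint ((integralModelInt W).map (Int.castRingHom ℤ_[q]))
        (Affine.Point.congrEquiv (W.padicModel_baseChange q).symm P) := by
  set V := (integralModelInt W).map (Int.castRingHom ℤ_[q]) with hV
  have hΔ : IsUnit V.Δ := W.isUnit_Δ_padicModel q hgood
  exact ⟨(goodReductionHom V (padicInt_valuationIntegers q) hΔ).comp
    (Affine.Point.congrEquiv (W.padicModel_baseChange q).symm).toAddMonoidHom, fun P ↦ rfl⟩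

/-- **`E(ℚ_q)[n] ≃+ W̃(𝔽_q)[n]` for a good prime `q ∤ n`** (Silverman *AEC* VII.3.1(b) in its
local form: the reduction map is injective on the prime-to-`q` torsion, and — `E₁(ℚ_q)` being
`n`-divisible — onto the `n`-torsion of the reduction). [cite: SilvermanAEC2009, Prop. VII.3.1(b) and Prop. VII.2.1] -/
theorem nonempty_kerEquiv_reduction (hgood : ¬ (q : ℤ) ∣ minimalDiscriminantInt W) {n : ℕ}
    (hn : ¬ q ∣ n) :
    Nonempty ((zsmulAddGroupHom (n : ℤ) : (W.baseChange ℚ_[q]).toAffine.Point →+ _).ker ≃+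
      (zsmulAddGroupHom (n : ℤ) :
        (((integralModelInt W).map (Int.castRingHom ℤ_[q])).map
          (IsLocalRing.residue ℤ_[q])).toAffine.Point →+ _).ker) := by
  obtain ⟨r, hr⟩ := exists_reductionHom hgood
  have hsurj : Function.Surjective r := by
    intro c
    obtain ⟨P, hP⟩ := reducePoint_congrEquiv_surjective (W := W) (q := q) c
    exact ⟨P, (hr P).trans hP⟩
  have hker : ∀ P, r P = 0 ↔ (W.baseChange ℚ_[q]).IsInReductionKernel P := fun P ↦ by
    rw [hr P]; exact reducePoint_congrEquiv_eq_zero_iff hgood P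
  refine nonempty_kerEquiv_of_surjective r hsurj n (fun b hb hnb ↦ ?_) (fun b hb ↦ ?_)
  · exact eq_zero_of_nsmul_eq_zero_of_isInReductionKernel (W.baseChange ℚ_[q]) hn
      ((hker b).mp hb) hnb
  · obtain ⟨b', hb', h⟩ := exists_nsmul_eq_of_isInReductionKernel (W.baseChange ℚ_[q]) hn
      ((hker b).mp hb)
    exact ⟨b', (hker b').mpr hb', h⟩

/-- **`E(ℚ_q)[n] = 0 ↔ W̃(𝔽_q)[n] = 0`** for a good prime `q ∤ n`. [cite: SilvermanAEC2009, Prop. VII.3.1(b) and Prop. VII.2.1] -/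
theorem forall_nsmul_eq_zero_iff_reduction (hgood : ¬ (q : ℤ) ∣ minimalDiscriminantInt W) {n : ℕ}
    (hn : ¬ q ∣ n) :
    (∀ P : (W.baseChange ℚ_[q]).toAffine.Point, n • P = 0 → P = 0) ↔
      ∀ c : (((integralModelInt W).map (Int.castRingHom ℤ_[q])).map
        (IsLocalRing.residue ℤ_[q])).toAffine.Point, n • c = 0 → c = 0 := by
  obtain ⟨r, hr⟩ := exists_reductionHom hgood
  have hsurj : Function.Surjective r := by
    intro c
    obtain ⟨P, hP⟩ := reducePoint_congrEquiv_surjective (W := W) (q := q) c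
    exact ⟨P, (hr P).trans hP⟩
  have hker : ∀ P, r P = 0 ↔ (W.baseChange ℚ_[q]).IsInReductionKernel P := fun P ↦ by
    rw [hr P]; exact reducePoint_congrEquiv_eq_zero_iff hgood P
  refine forall_nsmul_eq_zero_iff_of_surjective r hsurj (fun b hb hnb ↦ ?_) (fun b hb ↦ ?_)
  · exact eq_zero_of_nsmul_eq_zero_of_isInReductionKernel (W.baseChange ℚ_[q]) hn
      ((hker b).mp hb) hnb
  · obtain ⟨b', hb', h⟩ := exists_nsmul_eq_of_isInReductionKernel (W.baseChange ℚ_[q]) hn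
      ((hker b).mp hb)
    exact ⟨b', (hker b').mpr hb', h⟩

/-- **`P ∈ n·E(ℚ_q) ↔ P̃ ∈ n·W̃(𝔽_q)`** for a good prime `q ∤ n` (the cokernel side of the same
sequence: `E(ℚ_q)/n ≅ W̃(𝔽_q)/n`). [cite: SilvermanAEC2009, Prop. VII.2.1 and Prop. IV.2.3] -/
theorem exists_nsmul_eq_iff_reduction (hgood : ¬ (q : ℤ) ∣ minimalDiscriminantInt W) {n : ℕ}
    (hn : ¬ q ∣ n) (P : (W.baseChange ℚ_[q]).toAffine.Point) :
    (∃ Q : (W.baseChange ℚ_[q]).toAffine.Point, n • Q = P) ↔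
      ∃ c : (((integralModelInt W).map (Int.castRingHom ℤ_[q])).map
        (IsLocalRing.residue ℤ_[q])).toAffine.Point,
        n • c = reducePoint ((integralModelInt W).map (Int.castRingHom ℤ_[q]))
          (Affine.Point.congrEquiv (W.padicModel_baseChange q).symm P) := by
  obtain ⟨r, hr⟩ := exists_reductionHom hgood
  have hsurj : Function.Surjective r := by
    intro c
    obtain ⟨P, hP⟩ := reducePoint_congrEquiv_surjective (W := W) (q := q) c
    exact ⟨P, (hr P).trans hP⟩
  have hker : ∀ P, r P = 0 ↔ (W.baseChange ℚ_[q]).IsInReductionKernel P := fun P ↦ by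
    rw [hr P]; exact reducePoint_congrEquiv_eq_zero_iff hgood P
  rw [← hr P]
  refine exists_nsmul_eq_iff_of_surjective r hsurj (fun b hb ↦ ?_) P
  obtain ⟨b', hb', h⟩ := exists_nsmul_eq_of_isInReductionKernel (W.baseChange ℚ_[q]) hn
    ((hker b).mp hb)
  exact ⟨b', (hker b').mpr hb', h⟩

end GoodPrime

end WeierstrassCurve

end
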